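import Summits.Langlands.Langlands.Theorems.IrreducibilityBySelfDualityIrreducibleOffSectorTransfer
import Literature.NumberTheory.GaloisRepresentations.GaloisRepOfLadicLimit
import Mathlib.LinearAlgebra.Matrix.Kronecker
import HarnessLib

/-!
# Tensor products of framed representations and their Frobenius polynomials
(crux stmt-Langlands-14329 `IrreducibilityBySelfDuality.IrreducibleOffSector`, line `Sketch`;
`--supports` file, STRUCTURAL: no import of the route module; continuation lead c5)

Galois-side engine of the TENSOR-PRODUCT (Rankin–Selberg) ASCENT operator for the crux
(`…IrreducibleOffSectorTensorAscent`): the Kronecker product `ρ₁ ⊗ ρ₂ : G →ₜ* GL_{mn}(A)` of two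
framed continuous representations and its characteristic polynomials.  No definition is
introduced: the tensor product is packaged existentially (`exists_tensor`: a framed representation
whose matrices are `reindex (ρ₁ g ⊗ₖ ρ₂ g)`, Mathlib `Matrix.kronecker`, `finProdFinEquiv`), and
every statement below is about ANY `ρ` with that matrix formula (so it applies verbatim to a
future Literature definition).

* `kronecker_pow`, `sum_map_mul_sum_map`, `map_mul_product` — bookkeeping;
* `charpoly_kronecker_eq_prod` — over an algebraically closed field of characteristic `0`:
  `χ_A = ∏_{a ∈ s} (X - a)`, `χ_B = ∏_{b ∈ t} (X - b)` ⟹ `χ_{A ⊗ B} = ∏_{(a,b) ∈ s × t} (X - ab)`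
  (power traces `tr((A ⊗ B)^j) = tr(A^j) tr(B^j)`, Mathlib `Matrix.trace_kronecker`, are the power
  sums of `{ab}`; Newton's identities `LadicLimit.multiset_eq_of_psum_eq` and
  `LadicLimit.matrix_trace_pow_eq_sum_roots_pow` of the tree);
* `exists_tensor` — the framed tensor product exists (continuity entrywise);
* `tensor_apply_eq_one`, `isUnramifiedAt_tensor` — `ρ₁ g = 1 ∧ ρ₂ g = 1 ⇒ (ρ₁ ⊗ ρ₂) g = 1`;
  unramified where both factors are;
* `charpoly_tensor_eq_prod`, `hasFrobCharpolyAt_tensor` — Frobenius polynomials multiply root-wise;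
* `arithFrobPolyOfSatake_one_tensor` — `arithFrobPolyOfSatake ι q 1 (α ⊙ β)`, `α ⊙ β = {ab}`, is the
  root-wise product of `arithFrobPolyOfSatake ι q 1 α` and `… β` (the map `a ↦ ι⁻¹(a⁻¹)` is
  multiplicative), so `hasFrobCharpolyAt_tensor_arithFrobPolyOfSatake`: avatars compatible with
  Satake data `α`, `β` tensor to an avatar compatible with `α ⊙ β`.

References: J.-P. Serre, *Linear representations of finite groups* (1977), §1.5 (tensor product,
`χ_{ρ₁⊗ρ₂} = χ_{ρ₁} χ_{ρ₂}`); N. Bourbaki, *Algèbre*, Ch. IV §6 no. 5 (Newton), Ch. VII §5 no. 5;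
D. Ramakrishnan, Ann. of Math. 152 (2000), §1 (`⊠ : GL_2 × GL_2 → GL_4` at unramified places).
-/

noncomputable section

set_option linter.dupNamespace false

open scoped NumberField Classical Polynomial Matrix Kronecker
open Filter IsDedekindDomain Polynomial
open Literature.NumberTheory.Automorphic Literature.NumberTheory.GaloisRepresentations
open Summit.Langlands

namespace Summit.Langlands.Langlands.Theorems.IrreducibleOffSector

/-! ## 1. Bookkeeping -/

section Bookkeeping

/-- `(A ⊗ₖ B)^j = A^j ⊗ₖ B^j` (Mathlib `Matrix.mul_kronecker_mul`, `Matrix.one_kronecker_one`).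
[folklore] -/
theorem kronecker_pow {R : Type*} [CommRing R] {m n : Type*} [Fintype m] [Fintype n]
    [DecidableEq m] [DecidableEq n] (A : Matrix m m R) (B : Matrix n n R) (j : ℕ) :
    (A ⊗ₖ B) ^ j = (A ^ j) ⊗ₖ (B ^ j) := by
  induction j with
  | zero => simp
  | succ j ih => rw [pow_succ, ih, pow_succ, pow_succ, Matrix.mul_kronecker_mul]

/-- `(Σ_{a ∈ s} f a) (Σ_{b ∈ t} g b) = Σ_{(a,b) ∈ s × t} f a · g b` for multisets. [folklore] -/
theorem sum_map_mul_sum_map {R : Type*} [CommSemiring R] {α β : Type*} (s : Multiset α)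
    (t : Multiset β) (f : α → R) (g : β → R) :
    (s.map f).sum * (t.map g).sum = ((s ×ˢ t).map fun p => f p.1 * g p.2).sum := by
  induction s using Multiset.induction_on with
  | empty => simp
  | cons a s ih =>
    rw [Multiset.map_cons, Multiset.sum_cons, add_mul, ih, Multiset.cons_product, Multiset.map_add,
      Multiset.sum_add, Multiset.map_map]
    congr 1
    simp [Multiset.sum_map_mul_left]

/-- A multiplicative map commutes with "multiset of pairwise products":
`φ(s ⊙ t) = φ(s) ⊙ φ(t)`. [folklore] -/
theorem map_mul_product {M N : Type*} [Mul M] [Mul N] {F : Type*} [FunLike F M N]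
    [MulHomClass F M N] (φ : F) (s t : Multiset M) :
    ((s ×ˢ t).map fun p => φ (p.1 * p.2)) =
      (((s.map φ) ×ˢ (t.map φ)).map fun p => p.1 * p.2) := by
  induction s using Multiset.induction_on with
  | empty => simp
  | cons a s ih =>
    rw [Multiset.cons_product, Multiset.map_add, ih, Multiset.map_cons, Multiset.cons_product,
      Multiset.map_add, Multiset.map_map, Multiset.map_map]
    congr 1
    simp only [Function.comp_def, map_mul, Multiset.map_map]

end Bookkeeping

/-! ## 2. The characteristic polynomial of a Kronecker product -/

section Charpoly

variable {F : Type*} [Field F] [IsAlgClosed F] [CharZero F] {m n : Type*} [Fintype m] [Fintype n]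
  [DecidableEq m] [DecidableEq n]

/-- **`χ_{A ⊗ B} = ∏_{(a,b)} (X - ab)`.**  Over an algebraically closed field of characteristic
zero, if `χ_A = ∏_{a ∈ s} (X - a)` and `χ_B = ∏_{b ∈ t} (X - b)` then the Kronecker product has
`χ_{A ⊗ₖ B} = ∏_{(a,b) ∈ s × t} (X - ab)`.  Proof by Newton's identities: for `j ≥ 1`,
`tr((A ⊗ B)^j) = tr(A^j ⊗ B^j) = tr(A^j) tr(B^j) = (Σ a^j)(Σ b^j) = Σ (ab)^j`, and a multiset of
the right cardinality is determined by its power sums in characteristic zero.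
[cite: SerreLinearRepresentations1977, §1.5] -/
theorem charpoly_kronecker_eq_prod {A : Matrix m m F} {B : Matrix n n F} {s t : Multiset F}
    (hA : A.charpoly = (s.map fun a => X - C a).prod)
    (hB : B.charpoly = (t.map fun b => X - C b).prod) :
    (A ⊗ₖ B).charpoly = ((s ×ˢ t).map fun p => X - C (p.1 * p.2)).prod := by
  -- cardinalities
  have hsA : A.charpoly.roots = s := by rw [hA, roots_multiset_prod_X_sub_C]
  have hsB : B.charpoly.roots = t := by rw [hB, roots_multiset_prod_X_sub_C]
  have hcs : Multiset.card s = Fintype.card m := by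
    rw [← hsA, ← (IsAlgClosed.splits A.charpoly).natDegree_eq_card_roots,
      Matrix.charpoly_natDegree_eq_dim]
  have hct : Multiset.card t = Fintype.card n := by
    rw [← hsB, ← (IsAlgClosed.splits B.charpoly).natDegree_eq_card_roots,
      Matrix.charpoly_natDegree_eq_dim]
  set r := (A ⊗ₖ B).charpoly.roots with hr
  have hcr : Multiset.card r = Fintype.card (m × n) := by
    rw [hr, ← (IsAlgClosed.splits (A ⊗ₖ B).charpoly).natDegree_eq_card_roots,
      Matrix.charpoly_natDegree_eq_dim]
  set u : Multiset F := (s ×ˢ t).map fun p => p.1 * p.2 with hu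
  have hcu : Multiset.card u = Fintype.card (m × n) := by
    rw [hu, Multiset.card_map, Multiset.card_product, hcs, hct, Fintype.card_prod]
  -- power sums
  have hpsum : ∀ j : ℕ, (r.map (· ^ j)).sum = (u.map (· ^ j)).sum := by
    intro j
    rw [hr, ← LadicLimit.matrix_trace_pow_eq_sum_roots_pow, kronecker_pow, Matrix.trace_kronecker,
      LadicLimit.matrix_trace_pow_eq_sum_roots_pow, LadicLimit.matrix_trace_pow_eq_sum_roots_pow,
      hsA, hsB, sum_map_mul_sum_map, hu, Multiset.map_map]
    refine congrArg _ (Multiset.map_congr rfl fun p _ => ?_)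
    simp [mul_pow]
  have hru : r = u := LadicLimit.multiset_eq_of_psum_eq hcr hcu fun j _ _ => hpsum j
  -- the monic split polynomial is the product over its roots
  have hsplit : (A ⊗ₖ B).charpoly = (r.map fun a => X - C a).prod :=
    (prod_multiset_X_sub_C_of_monic_of_roots_card_eq (Matrix.charpoly_monic _)
      (IsAlgClosed.card_roots_eq_natDegree)).symm
  rw [hsplit, hru, hu, Multiset.map_map]
  rfl

end Charpoly

/-! ## 3. The framed tensor product -/

section Tensor

variable {G : Type*} [Group G] [TopologicalSpace G] {A : Type*} [CommRing A] [TopologicalSpace A]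
  {m n : ℕ}

/-- The matrix-valued homomorphism `g ↦ reindex (ρ₁ g ⊗ₖ ρ₂ g)` underlying the tensor product
(`Matrix.mul_kronecker_mul`; relabelling `Fin m × Fin n ≃ Fin (m n)` by `finProdFinEquiv`).
[cite: SerreLinearRepresentations1977, §1.5] -/
theorem exists_tensorMatrixHom (ρ₁ : FramedRep G A m) (ρ₂ : FramedRep G A n) :
    ∃ φ : G →* Matrix (Fin (m * n)) (Fin (m * n)) A, ∀ g : G,
      φ g = Matrix.reindex finProdFinEquiv finProdFinEquiv
        (((ρ₁ g : GL (Fin m) A) : Matrix (Fin m) (Fin m) A) ⊗ₖ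
          ((ρ₂ g : GL (Fin n) A) : Matrix (Fin n) (Fin n) A)) := by
  let κ : G →* Matrix (Fin m × Fin n) (Fin m × Fin n) A :=
    { toFun := fun g => ((ρ₁ g : GL (Fin m) A) : Matrix (Fin m) (Fin m) A) ⊗ₖ
        ((ρ₂ g : GL (Fin n) A) : Matrix (Fin n) (Fin n) A)
      map_one' := by simp only [map_one, Units.val_one, Matrix.one_kronecker_one]
      map_mul' := fun g h => by simp only [map_mul, Units.val_mul, Matrix.mul_kronecker_mul] }
  refine ⟨((Matrix.reindexAlgEquiv A A (finProdFinEquiv : Fin m × Fin n ≃ Fin (m * n))).toRingEquiv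
    : Matrix (Fin m × Fin n) (Fin m × Fin n) A ≃+* _).toMonoidHom.comp κ, fun g => ?_⟩
  rfl

/-- **The framed tensor product exists.**  For framed continuous representations
`ρ₁ : G →ₜ* GL_m(A)`, `ρ₂ : G →ₜ* GL_n(A)` over a topological ring there is a framed continuous
representation `ρ : G →ₜ* GL_{mn}(A)` with matrices `ρ(g) = reindex (ρ₁(g) ⊗ₖ ρ₂(g))` — the
representation `ρ₁ ⊗ ρ₂` on `Aᵐ ⊗ Aⁿ = A^{mn}` in the basis `e_i ⊗ f_k ↦ finProdFinEquiv (i, k)`.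
Continuity: the entries `ρ₁(g)_{ij} ρ₂(g)_{kl}` are continuous, and `ρ(g)⁻¹ = ρ(g⁻¹)`.
[cite: SerreLinearRepresentations1977, §1.5] -/
theorem exists_tensor [IsTopologicalRing A] [IsTopologicalGroup G] (ρ₁ : FramedRep G A m)
    (ρ₂ : FramedRep G A n) :
    ∃ ρ : FramedRep G A (m * n), ∀ g : G,
      ((ρ g : GL (Fin (m * n)) A) : Matrix (Fin (m * n)) (Fin (m * n)) A) =
        Matrix.reindex finProdFinEquiv finProdFinEquiv
          (((ρ₁ g : GL (Fin m) A) : Matrix (Fin m) (Fin m) A) ⊗ₖ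
            ((ρ₂ g : GL (Fin n) A) : Matrix (Fin n) (Fin n) A)) := by
  obtain ⟨φ, hφ⟩ := exists_tensorMatrixHom ρ₁ ρ₂
  have hcont : Continuous φ := by
    refine continuous_matrix fun x y => ?_
    have h1 : Continuous fun g : G =>
        ((ρ₁ g : GL (Fin m) A) : Matrix (Fin m) (Fin m) A) (finProdFinEquiv.symm x).1
          (finProdFinEquiv.symm y).1 :=
      (Units.continuous_val.comp ρ₁.continuous).matrix_elem _ _
    have h2 : Continuous fun g : G =>
        ((ρ₂ g : GL (Fin n) A) : Matrix (Fin n) (Fin n) A) (finProdFinEquiv.symm x).2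
          (finProdFinEquiv.symm y).2 :=
      (Units.continuous_val.comp ρ₂.continuous).matrix_elem _ _
    convert h1.mul h2 using 1
    funext g
    rw [hφ g, Matrix.reindex_apply, Matrix.submatrix_apply]
    exact Matrix.kroneckerMap_apply _ _ _ _ _
  refine ⟨⟨φ.toHomUnits, Units.continuous_iff.2 ⟨hcont, hcont.comp continuous_inv⟩⟩, fun g => ?_⟩
  exact hφ g

variable {ρ₁ : FramedRep G A m} {ρ₂ : FramedRep G A n} {ρ : FramedRep G A (m * n)}

/-- If `ρ₁ g = 1` and `ρ₂ g = 1` then `(ρ₁ ⊗ ρ₂) g = 1`. [folklore] -/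
theorem tensor_apply_eq_one
    (hρ : ∀ g : G, ((ρ g : GL (Fin (m * n)) A) : Matrix (Fin (m * n)) (Fin (m * n)) A) =
      Matrix.reindex finProdFinEquiv finProdFinEquiv
        (((ρ₁ g : GL (Fin m) A) : Matrix (Fin m) (Fin m) A) ⊗ₖ
          ((ρ₂ g : GL (Fin n) A) : Matrix (Fin n) (Fin n) A)))
    {g : G} (h₁ : ρ₁ g = 1) (h₂ : ρ₂ g = 1) : ρ g = 1 := by
  apply Units.ext
  rw [hρ g, h₁, h₂, Units.val_one, Units.val_one, Matrix.one_kronecker_one, Units.val_one,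
    Matrix.reindex_apply, Matrix.submatrix_one_equiv]

/-- **`χ_{(ρ₁ ⊗ ρ₂)(g)} = ∏_{(a,b)} (X - ab)`** when `χ_{ρ₁(g)} = ∏_{a ∈ s} (X - a)` and
`χ_{ρ₂(g)} = ∏_{b ∈ t} (X - b)` (algebraically closed coefficients of characteristic zero;
`charpoly_kronecker_eq_prod`, `Matrix.charpoly_reindex`). [cite: SerreLinearRepresentations1977, §1.5] -/
theorem charpoly_tensor_eq_prod {G : Type*} [Group G] [TopologicalSpace G] {F : Type*} [Field F]
    [IsAlgClosed F] [CharZero F] [TopologicalSpace F] {m n : ℕ}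
    {ρ₁ : FramedRep G F m} {ρ₂ : FramedRep G F n} {ρ : FramedRep G F (m * n)}
    (hρ : ∀ g : G, ((ρ g : GL (Fin (m * n)) F) : Matrix (Fin (m * n)) (Fin (m * n)) F) =
      Matrix.reindex finProdFinEquiv finProdFinEquiv
        (((ρ₁ g : GL (Fin m) F) : Matrix (Fin m) (Fin m) F) ⊗ₖ
          ((ρ₂ g : GL (Fin n) F) : Matrix (Fin n) (Fin n) F)))
    {g : G} {s t : Multiset F} (h₁ : FramedRep.charpoly ρ₁ g = (s.map fun a => X - C a).prod)
    (h₂ : FramedRep.charpoly ρ₂ g = (t.map fun b => X - C b).prod) :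
    FramedRep.charpoly ρ g = ((s ×ˢ t).map fun p => X - C (p.1 * p.2)).prod := by
  unfold FramedRep.charpoly at h₁ h₂ ⊢
  rw [hρ g, Matrix.charpoly_reindex, charpoly_kronecker_eq_prod h₁ h₂]

end Tensor

/-! ## 4. Galois predicates: unramifiedness and Frobenius polynomials of a tensor product -/

section Galois

variable {K : Type} [Field K] {A : Type*} [CommRing A] [TopologicalSpace A]
  {m n : ℕ} {ρ₁ : FramedGaloisRep K A m} {ρ₂ : FramedGaloisRep K A n}
  {ρ : FramedGaloisRep K A (m * n)}

/-- **`ρ₁ ⊗ ρ₂` is unramified wherever `ρ₁` and `ρ₂` are.** [cite: SerreAbelianLadic1968, Ch. I §2.1] -/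
theorem isUnramifiedAt_tensor
    (hρ : ∀ g, ((ρ g : GL (Fin (m * n)) A) : Matrix (Fin (m * n)) (Fin (m * n)) A) =
      Matrix.reindex finProdFinEquiv finProdFinEquiv
        (((ρ₁ g : GL (Fin m) A) : Matrix (Fin m) (Fin m) A) ⊗ₖ
          ((ρ₂ g : GL (Fin n) A) : Matrix (Fin n) (Fin n) A)))
    {v : HeightOneSpectrum (𝓞 K)} (h₁ : ρ₁.IsUnramifiedAt v) (h₂ : ρ₂.IsUnramifiedAt v) :
    ρ.IsUnramifiedAt v :=
  fun 𝔓 h𝔓 σ hσ => tensor_apply_eq_one hρ (h₁ 𝔓 h𝔓 σ hσ) (h₂ 𝔓 h𝔓 σ hσ)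

/-- **Frobenius polynomials of `ρ₁ ⊗ ρ₂` multiply root-wise** (algebraically closed coefficients of
characteristic zero): `χ_{ρ₁}(Frob_v) = ∏_{a ∈ s}(X - a)` and `χ_{ρ₂}(Frob_v) = ∏_{b ∈ t}(X - b)` give
`χ_{ρ₁⊗ρ₂}(Frob_v) = ∏_{(a,b)}(X - ab)`. [cite: SerreLinearRepresentations1977, §1.5] -/
theorem hasFrobCharpolyAt_tensor {F : Type*} [Field F] [IsAlgClosed F] [CharZero F]
    [TopologicalSpace F] {ρ₁ : FramedGaloisRep K F m}
    {ρ₂ : FramedGaloisRep K F n} {ρ : FramedGaloisRep K F (m * n)}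
    (hρ : ∀ g, ((ρ g : GL (Fin (m * n)) F) : Matrix (Fin (m * n)) (Fin (m * n)) F) =
      Matrix.reindex finProdFinEquiv finProdFinEquiv
        (((ρ₁ g : GL (Fin m) F) : Matrix (Fin m) (Fin m) F) ⊗ₖ
          ((ρ₂ g : GL (Fin n) F) : Matrix (Fin n) (Fin n) F)))
    {v : HeightOneSpectrum (𝓞 K)} {s t : Multiset F}
    (h₁ : ρ₁.HasFrobCharpolyAt v (s.map fun a => X - C a).prod)
    (h₂ : ρ₂.HasFrobCharpolyAt v (t.map fun b => X - C b).prod) :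
    ρ.HasFrobCharpolyAt v ((s ×ˢ t).map fun p => X - C (p.1 * p.2)).prod :=
  fun 𝔓 h𝔓 σ hσ => charpoly_tensor_eq_prod hρ (h₁ 𝔓 h𝔓 σ hσ) (h₂ 𝔓 h𝔓 σ hσ)

end Galois

/-! ## 5. Satake side: `arithFrobPolyOfSatake ι q 1 (α ⊙ β)` -/

section Satake

variable {ℓ : ℕ} [Fact ℓ.Prime]

/-- `arithFrobPolyOfSatake ι q 1 α = ∏_{a' ∈ α.map (a ↦ ι⁻¹(a⁻¹))} (X - a')`. [folklore] -/
theorem arithFrobPolyOfSatake_one_eq_prod_map (ι : PadicAlgCl ℓ ≃+* ℂ) (q : ℕ) (α : Multiset ℂ) :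
    arithFrobPolyOfSatake ι q 1 α =
      ((α.map fun a => ι.symm a⁻¹).map fun a' => X - C a').prod := by
  rw [arithFrobPolyOfSatake_one, Multiset.map_map]
  rfl

/-- **The predicted Frobenius polynomial of the pairwise product `α ⊙ β = {ab}`** is the root-wise
product of those of `α` and `β`: the dictionary `a ↦ ι⁻¹(a⁻¹)` is multiplicative.
[cite: BuzzardGeeLMS2014, §2.1 and Rem. 3.2.5] -/
theorem arithFrobPolyOfSatake_one_tensor (ι : PadicAlgCl ℓ ≃+* ℂ) (q : ℕ) (α β : Multiset ℂ) :
    arithFrobPolyOfSatake ι q 1 ((α ×ˢ β).map fun p => p.1 * p.2) =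
      ((((α.map fun a => ι.symm a⁻¹) ×ˢ (β.map fun b => ι.symm b⁻¹)).map
        fun p => X - C (p.1 * p.2))).prod := by
  rw [arithFrobPolyOfSatake_one_eq_prod_map, Multiset.map_map]
  -- the dictionary as a multiplicative map `ℂ →* ℚ̄_ℓ`
  let φ : ℂ →* PadicAlgCl ℓ :=
    { toFun := fun a => ι.symm a⁻¹
      map_one' := by simp
      map_mul' := fun a b => by simp [mul_comm] }
  have hφ : ∀ a : ℂ, φ a = ι.symm a⁻¹ := fun a => rfl
  have h := map_mul_product φ α β
  have e1 : ((α ×ˢ β).map fun p => p.1 * p.2).map (fun a => ι.symm a⁻¹) =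
      (α ×ˢ β).map fun p => φ (p.1 * p.2) := by
    rw [Multiset.map_map]; rfl
  rw [← Multiset.map_map, e1, h]
  simp only [Multiset.map_map, Function.comp_def, hφ]

end Satake

/-- **Tensor of Satake-compatible avatars.**  If the arithmetic Frobenii at `v` have characteristic
polynomial `arithFrobPolyOfSatake ι q 1 α` on `ρ₁` and `arithFrobPolyOfSatake ι q 1 β` on `ρ₂`, then
on `ρ₁ ⊗ ρ₂` they have characteristic polynomial `arithFrobPolyOfSatake ι q 1 (α ⊙ β)`,
`α ⊙ β = {ab : a ∈ α, b ∈ β}` — the unramified local tensor product (Rankin–Selberg) functoriality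
`GL_m × GL_n → GL_{mn}` on the Galois side. [cite: SerreLinearRepresentations1977, §1.5]
[cite: BuzzardGeeLMS2014, §2.1] -/
theorem hasFrobCharpolyAt_tensor_arithFrobPolyOfSatake {ℓ : ℕ} [Fact ℓ.Prime] {K : Type} [Field K]
    {m n : ℕ} {ρ₁ : FramedGaloisRep K (PadicAlgCl ℓ) m} {ρ₂ : FramedGaloisRep K (PadicAlgCl ℓ) n}
    {ρ : FramedGaloisRep K (PadicAlgCl ℓ) (m * n)}
    (hρ : ∀ g, ((ρ g : GL (Fin (m * n)) (PadicAlgCl ℓ)) : Matrix (Fin (m * n)) (Fin (m * n)) (PadicAlgCl ℓ)) =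
      Matrix.reindex finProdFinEquiv finProdFinEquiv
        (((ρ₁ g : GL (Fin m) (PadicAlgCl ℓ)) : Matrix (Fin m) (Fin m) (PadicAlgCl ℓ)) ⊗ₖ
          ((ρ₂ g : GL (Fin n) (PadicAlgCl ℓ)) : Matrix (Fin n) (Fin n) (PadicAlgCl ℓ))))
    (ι : PadicAlgCl ℓ ≃+* ℂ) {v : HeightOneSpectrum (𝓞 K)} (q : ℕ) {α β : Multiset ℂ}
    (h₁ : ρ₁.HasFrobCharpolyAt v (arithFrobPolyOfSatake ι q 1 α))
    (h₂ : ρ₂.HasFrobCharpolyAt v (arithFrobPolyOfSatake ι q 1 β)) :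
    ρ.HasFrobCharpolyAt v (arithFrobPolyOfSatake ι q 1 ((α ×ˢ β).map fun p => p.1 * p.2)) := by
  rw [arithFrobPolyOfSatake_one_tensor]
  rw [arithFrobPolyOfSatake_one_eq_prod_map] at h₁ h₂
  exact hasFrobCharpolyAt_tensor hρ h₁ h₂

end Summit.Langlands.Langlands.Theorems.IrreducibleOffSector

end
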